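import Summits.HodgeConjecture.HodgeConjecture.Theorems.AnchorTransportVariationalHodgePadicQPComposition

/-!
# Route AnchorTransport — crux `VariationalHodge` (stmt-HodgeConjecture-1076), line `padic-disc-transport`:
# the composition on quasi-projective carriers with STUB S WEAKENED to quasi-projective total spaces —
# `P ∧ S_QP ⟹ VariationalHodgeQP`

HONEST FRAMING: research route conditional on HC_CM; not a corollary; Q11.4-sentence-2 already refuted in dim ≥ 3.
Helper file on the crux item (nothing here closes it; no definition, no named fact, no `sorry`;
`HC_CM` does not occur). Cell `pub-hodge-ring2`, binder seat `ring2-b03` (gen 36), BINDER-OWNERS row b03.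

`AnchorTransportVariationalHodgePadicQPComposition` (gen 32) derives `Ring2.Hypotheses.VariationalHodgeQP`
from the bet `P` and STUB S verbatim — S quantified over ALL descended smooth projective families. Only
families with quasi-projective total space are ever fed to S in that composition, so the hypothesis may
be weakened to `S_QP` := S with the extra binder `IsQuasiProjectiveOver (𝒳₀ ⊗_σ ℂ)` (placed right
after the family `f₀`) — the form in
which the arithmetic disc is PROVED (gens 33–36: `padicDiscSupply_of_isQuasiProjectiveOver`, up to the
transport). This file re-runs the composition with `S_QP`:

* `arithmeticDiscSupplyQP_of_arithmeticDiscSupply` — `S ⟹ S_QP`;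
* `variationalHodgeQP_of_padicQP : P → S_QP → Ring2.Hypotheses.VariationalHodgeQP` and
  `flatSectionsAlgebraicQP_of_padicQP` (the intermediate chain — descended form, curve residual,
  projective and quasi-projective total spaces — is kept file-private: it is textually gen 32's).
-/

noncomputable section

-- every declaration of this problem lives in `Summit.HodgeConjecture.HodgeConjecture.…` (summit = sub-problem)
set_option linter.dupNamespace false

open CategoryTheory CategoryTheory.Limits AlgebraicGeometry TopologicalSpace MonoidalCategory
open Literature.AlgebraicGeometry.Motives Literature.AlgebraicGeometry.HodgeTheory
open Literature.AlgebraicGeometry.KTheory Literature.AlgebraicGeometry.Crystalline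
open Summit.HodgeConjecture.HodgeConjecture.Theses.AnchorTransport
open scoped Isocrystal

namespace Summit.HodgeConjecture.HodgeConjecture.Theorems


/-- **`S ⟹ S_QP`**: STUB S (`PadicDiscTransport.ArithmeticDiscSupply`, unfolded) trivially implies its
restriction to quasi-projective total spaces (the extra binder is discarded). Recorded so that the
composition below subsumes `variationalHodgeQP_of_padic` of
`AnchorTransportVariationalHodgePadicQPComposition`. [folklore] -/
theorem arithmeticDiscSupplyQP_of_arithmeticDiscSupply
    (hS : ∀ (N : ℕ) (k : Type) [Field k] [Countable k] (σ : k →+* ℂ) ⦃n : ℕ⦄ ⦃𝒳₀ S₀ : SchemeOver k⦄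
      (f₀ : 𝒳₀ ⟶ S₀),
      IsSmoothProjectiveFamily ((baseChangeHom σ).map f₀) n →
      IrreducibleSpace ((baseChangeHom σ).obj S₀).left → IsAffine ((baseChangeHom σ).obj S₀).left →
      AlgebraicGeometry.Smooth ((baseChangeHom σ).obj S₀).hom →
      topologicalKrullDim ((baseChangeHom σ).obj S₀).left = 1 →
      ∀ (p : ℕ) (A : complexBetti ((baseChangeHom σ).obj 𝒳₀) (2 * p)),
      (∀ s : ComplexPoints ((baseChangeHom σ).obj S₀),
        IsRationalClass (complexBetti.map (fiberι ((baseChangeHom σ).map f₀) s) (2 * p) A) ∧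
        IsOfHodgeType n (fiberOver ((baseChangeHom σ).map f₀) s) (2 * p) p p
          (complexBetti.map (fiberι ((baseChangeHom σ).map f₀) s) (2 * p) A)) →
      ∀ s₀ : ComplexPoints ((baseChangeHom σ).obj S₀),
        complexBetti.map (fiberι ((baseChangeHom σ).map f₀) s₀) (2 * p) A ∈
          algebraicClasses (fiberOver ((baseChangeHom σ).map f₀) s₀) p →
      ∃ (q : ℕ) (_ : Fact q.Prime) (κ : Type) (_ : Field κ) (_ : CharP κ q) (_ : PerfectRing κ q)
        (_ : IsAlgClosed κ) (_ : Algebra (ZMod q) κ) (_ : Algebra.IsAlgebraic (ZMod q) κ)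
        (𝒴 : SchemeOver (WittVector q κ))
        (ξ : ContinuousKZeroRat (Ideal.span {(q : WittVector q κ)}) 𝒴)
        (s : ComplexPoints ((baseChangeHom σ).obj S₀)) (ι : K(q, κ) →+* ℂ),
        N ≤ q ∧ WittScheme.IsSmoothProperModel n 𝒴 ∧
        (∀ Z : Set (ComplexPoints ((baseChangeHom σ).obj S₀)),
          IsDefinedOver σ S₀ σ.fieldRange Z → s ∈ Z → Z = Set.univ) ∧
        Nonempty ((baseChangeHom ι).obj (WittScheme.genericFibre 𝒴) ≅
          fiberOver ((baseChangeHom σ).map f₀) s) ∧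
        ((∃ η : KZeroRat 𝒴.left,
          KZeroRat.map (WittScheme.specialFibreι 𝒴) η =
            KZeroRat.map (specialFibreToTower 𝒴)
              (ContinuousKZeroRat.specialFibre (Ideal.span {(q : WittVector q κ)}) 𝒴 ξ)) →
          complexBetti.map (fiberι ((baseChangeHom σ).map f₀) s) (2 * p) A ∈
            algebraicClasses (fiberOver ((baseChangeHom σ).map f₀) s) p))
    (N : ℕ) (k : Type) [Field k] [Countable k] (σ : k →+* ℂ) ⦃n : ℕ⦄ ⦃𝒳₀ S₀ : SchemeOver k⦄
    (f₀ : 𝒳₀ ⟶ S₀) (_h𝒳 : IsQuasiProjectiveOver ((baseChangeHom σ).obj 𝒳₀))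
    (hf : IsSmoothProjectiveFamily ((baseChangeHom σ).map f₀) n)
    (hirr : IrreducibleSpace ((baseChangeHom σ).obj S₀).left)
    (haff : IsAffine ((baseChangeHom σ).obj S₀).left)
    (hsm : AlgebraicGeometry.Smooth ((baseChangeHom σ).obj S₀).hom)
    (hdim : topologicalKrullDim ((baseChangeHom σ).obj S₀).left = 1)
    (p : ℕ) (A : complexBetti ((baseChangeHom σ).obj 𝒳₀) (2 * p))
    (hA : ∀ s : ComplexPoints ((baseChangeHom σ).obj S₀),
      IsRationalClass (complexBetti.map (fiberι ((baseChangeHom σ).map f₀) s) (2 * p) A) ∧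
      IsOfHodgeType n (fiberOver ((baseChangeHom σ).map f₀) s) (2 * p) p p
        (complexBetti.map (fiberι ((baseChangeHom σ).map f₀) s) (2 * p) A))
    (s₀ : ComplexPoints ((baseChangeHom σ).obj S₀))
    (hs₀ : complexBetti.map (fiberι ((baseChangeHom σ).map f₀) s₀) (2 * p) A ∈
      algebraicClasses (fiberOver ((baseChangeHom σ).map f₀) s₀) p) :
    ∃ (q : ℕ) (_ : Fact q.Prime) (κ : Type) (_ : Field κ) (_ : CharP κ q) (_ : PerfectRing κ q)
      (_ : IsAlgClosed κ) (_ : Algebra (ZMod q) κ) (_ : Algebra.IsAlgebraic (ZMod q) κ)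
      (𝒴 : SchemeOver (WittVector q κ))
      (ξ : ContinuousKZeroRat (Ideal.span {(q : WittVector q κ)}) 𝒴)
      (s : ComplexPoints ((baseChangeHom σ).obj S₀)) (ι : K(q, κ) →+* ℂ),
      N ≤ q ∧ WittScheme.IsSmoothProperModel n 𝒴 ∧
      (∀ Z : Set (ComplexPoints ((baseChangeHom σ).obj S₀)),
        IsDefinedOver σ S₀ σ.fieldRange Z → s ∈ Z → Z = Set.univ) ∧
      Nonempty ((baseChangeHom ι).obj (WittScheme.genericFibre 𝒴) ≅
        fiberOver ((baseChangeHom σ).map f₀) s) ∧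
      ((∃ η : KZeroRat 𝒴.left,
        KZeroRat.map (WittScheme.specialFibreι 𝒴) η =
          KZeroRat.map (specialFibreToTower 𝒴)
            (ContinuousKZeroRat.specialFibre (Ideal.span {(q : WittVector q κ)}) 𝒴 ξ)) →
        complexBetti.map (fiberι ((baseChangeHom σ).map f₀) s) (2 * p) A ∈
          algebraicClasses (fiberOver ((baseChangeHom σ).map f₀) s) p) :=
  hS N k σ f₀ hf hirr haff hsm hdim p A hA s₀ hs₀

section PadicQP

-- S_QP: STUB S (`PadicDiscTransport.ArithmeticDiscSupply`, `IsGenericPoint` / `ProClassAlgebraizes`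
-- unfolded) with the one extra binder `IsQuasiProjectiveOver (𝒳₀ ⊗_σ ℂ)`.
variable
  (hSQP : ∀ (N : ℕ) (k : Type) [Field k] [Countable k] (σ : k →+* ℂ) ⦃n : ℕ⦄ ⦃𝒳₀ S₀ : SchemeOver k⦄
    (f₀ : 𝒳₀ ⟶ S₀), IsQuasiProjectiveOver ((baseChangeHom σ).obj 𝒳₀) →
    IsSmoothProjectiveFamily ((baseChangeHom σ).map f₀) n →
    IrreducibleSpace ((baseChangeHom σ).obj S₀).left → IsAffine ((baseChangeHom σ).obj S₀).left →
    AlgebraicGeometry.Smooth ((baseChangeHom σ).obj S₀).hom →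
    topologicalKrullDim ((baseChangeHom σ).obj S₀).left = 1 →
    ∀ (p : ℕ) (A : complexBetti ((baseChangeHom σ).obj 𝒳₀) (2 * p)),
    (∀ s : ComplexPoints ((baseChangeHom σ).obj S₀),
      IsRationalClass (complexBetti.map (fiberι ((baseChangeHom σ).map f₀) s) (2 * p) A) ∧
      IsOfHodgeType n (fiberOver ((baseChangeHom σ).map f₀) s) (2 * p) p p
        (complexBetti.map (fiberι ((baseChangeHom σ).map f₀) s) (2 * p) A)) →
    ∀ s₀ : ComplexPoints ((baseChangeHom σ).obj S₀),
      complexBetti.map (fiberι ((baseChangeHom σ).map f₀) s₀) (2 * p) A ∈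
        algebraicClasses (fiberOver ((baseChangeHom σ).map f₀) s₀) p →
    ∃ (q : ℕ) (_ : Fact q.Prime) (κ : Type) (_ : Field κ) (_ : CharP κ q) (_ : PerfectRing κ q)
      (_ : IsAlgClosed κ) (_ : Algebra (ZMod q) κ) (_ : Algebra.IsAlgebraic (ZMod q) κ)
      (𝒴 : SchemeOver (WittVector q κ))
      (ξ : ContinuousKZeroRat (Ideal.span {(q : WittVector q κ)}) 𝒴)
      (s : ComplexPoints ((baseChangeHom σ).obj S₀)) (ι : K(q, κ) →+* ℂ),
      N ≤ q ∧ WittScheme.IsSmoothProperModel n 𝒴 ∧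
      (∀ Z : Set (ComplexPoints ((baseChangeHom σ).obj S₀)),
        IsDefinedOver σ S₀ σ.fieldRange Z → s ∈ Z → Z = Set.univ) ∧
      Nonempty ((baseChangeHom ι).obj (WittScheme.genericFibre 𝒴) ≅
        fiberOver ((baseChangeHom σ).map f₀) s) ∧
      ((∃ η : KZeroRat 𝒴.left,
        KZeroRat.map (WittScheme.specialFibreι 𝒴) η =
          KZeroRat.map (specialFibreToTower 𝒴)
            (ContinuousKZeroRat.specialFibre (Ideal.span {(q : WittVector q κ)}) 𝒴 ξ)) →
        complexBetti.map (fiberι ((baseChangeHom σ).map f₀) s) (2 * p) A ∈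
          algebraicClasses (fiberOver ((baseChangeHom σ).map f₀) s) p))
-- P: the bet (`PadicDiscTransport.PadicImageAlgebraization`, `ProClassAlgebraizes` unfolded), verbatim.
  (hP : ∀ d : ℕ, ∃ p₀ : ℕ, ∀ (p : ℕ) [Fact p.Prime], p₀ ≤ p →
    ∀ (κ : Type) [Field κ] [CharP κ p] [PerfectRing κ p] [IsAlgClosed κ] [Algebra (ZMod p) κ],
    Algebra.IsAlgebraic (ZMod p) κ →
    ∀ (𝒴 : SchemeOver (WittVector p κ)), WittScheme.IsSmoothProperModel d 𝒴 →
    ∀ ξ : ContinuousKZeroRat (Ideal.span {(p : WittVector p κ)}) 𝒴,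
      ∃ η : KZeroRat 𝒴.left,
        KZeroRat.map (WittScheme.specialFibreι 𝒴) η =
          KZeroRat.map (specialFibreToTower 𝒴)
            (ContinuousKZeroRat.specialFibre (Ideal.span {(p : WittVector p κ)}) 𝒴 ξ))

include hSQP hP

/-- **`P ∧ S_QP ⟹ the descended crux on quasi-projective carriers** (the skeleton's
`variationalHodgeDescended_of`, with `S_QP` in place of `S` and `G` by
`genericPropagation_of_isQuasiProjectiveOver`). [cite: MaulikPoonen2012, §3–4]
[cite: AntieauMathewMorrowNikolaus2022, Conj. 1.3 and Thm. D] -/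
private theorem variationalHodgeDescendedQP_of_padicQP (k : Type) [Field k] [Countable k]
    (σ : k →+* ℂ) ⦃n : ℕ⦄ ⦃𝒳₀ S₀ : SchemeOver k⦄ (f₀ : 𝒳₀ ⟶ S₀)
    (hf : IsSmoothProjectiveFamily ((baseChangeHom σ).map f₀) n)
    (hirr : IrreducibleSpace ((baseChangeHom σ).obj S₀).left)
    (haff : IsAffine ((baseChangeHom σ).obj S₀).left)
    (hsm : AlgebraicGeometry.Smooth ((baseChangeHom σ).obj S₀).hom)
    (hdim : topologicalKrullDim ((baseChangeHom σ).obj S₀).left = 1)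
    (h𝒳 : IsQuasiProjectiveOver ((baseChangeHom σ).obj 𝒳₀))
    (p : ℕ) (A : complexBetti ((baseChangeHom σ).obj 𝒳₀) (2 * p))
    (hA : ∀ s : ComplexPoints ((baseChangeHom σ).obj S₀),
      IsRationalClass (complexBetti.map (fiberι ((baseChangeHom σ).map f₀) s) (2 * p) A) ∧
      IsOfHodgeType n (fiberOver ((baseChangeHom σ).map f₀) s) (2 * p) p p
        (complexBetti.map (fiberι ((baseChangeHom σ).map f₀) s) (2 * p) A))
    (hs₀ : ∃ s₀ : ComplexPoints ((baseChangeHom σ).obj S₀),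
      complexBetti.map (fiberι ((baseChangeHom σ).map f₀) s₀) (2 * p) A ∈
        algebraicClasses (fiberOver ((baseChangeHom σ).map f₀) s₀) p)
    (t : ComplexPoints ((baseChangeHom σ).obj S₀)) :
    complexBetti.map (fiberι ((baseChangeHom σ).map f₀) t) (2 * p) A ∈
      algebraicClasses (fiberOver ((baseChangeHom σ).map f₀) t) p := by
  obtain ⟨s₀, hs₀⟩ := hs₀
  obtain ⟨p₀, hp₀⟩ := hP n
  obtain ⟨q, hq, κ, hκF, hκC, hκP, hκA, hκAlg, hκalg, 𝒴, ξ, s, ι, hNq, h𝒴, hgen, -, himp⟩ :=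
    hSQP p₀ k σ f₀ h𝒳 hf hirr haff hsm hdim p A hA s₀ hs₀
  have halg : complexBetti.map (fiberι ((baseChangeHom σ).map f₀) s) (2 * p) A ∈
      algebraicClasses (fiberOver ((baseChangeHom σ).map f₀) s) p :=
    himp (hp₀ q hNq κ hκalg 𝒴 h𝒴 ξ)
  exact genericPropagation_of_isQuasiProjectiveOver k σ f₀ hf hirr haff hsm hdim h𝒳 p A s hgen halg t

/-- **`P ∧ S_QP ⟹ the crux over smooth irreducible affine CURVES for quasi-projective total spaces**
(STUB D's descent, `Limits.exists_countable_subfield_descent`, with quasi-projectivity carried along the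
isomorphism of families; then `variationalHodgeDescendedQP_of_padicQP`).
[cite: EGAIV3, Thm. 8.8.2 (ii)] [cite: MaulikPoonen2012, §3–4] -/
private theorem curveResidualQP_of_padicQP ⦃n : ℕ⦄ ⦃𝒳 S : SchemeOver ℂ⦄ (f : 𝒳 ⟶ S)
    (hf : IsSmoothProjectiveFamily f n) (h𝒳 : IsQuasiProjectiveOver 𝒳)
    (hirr : IrreducibleSpace S.left) (haff : IsAffine S.left) (hsm : AlgebraicGeometry.Smooth S.hom)
    (hdim : topologicalKrullDim S.left = 1) (p : ℕ) (A : complexBetti 𝒳 (2 * p))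
    (hA : ∀ s : ComplexPoints S, IsRationalClass (complexBetti.map (fiberι f s) (2 * p) A) ∧
      IsOfHodgeType n (fiberOver f s) (2 * p) p p (complexBetti.map (fiberι f s) (2 * p) A))
    (hs₀ : ∃ s₀ : ComplexPoints S,
      complexBetti.map (fiberι f s₀) (2 * p) A ∈ algebraicClasses (fiberOver f s₀) p)
    (s : ComplexPoints S) :
    complexBetti.map (fiberι f s) (2 * p) A ∈ algebraicClasses (fiberOver f s) p := by
  obtain ⟨s₀, hs₀⟩ := hs₀
  haveI := hirr
  haveI := haff
  haveI := hsm
  haveI : IsProper f.left := hf.isProper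
  haveI : IsAffineHom S.hom := isAffineHom_of_isAffine S.hom
  haveI : IsSeparated S.hom := inferInstance
  haveI : QuasiCompact S.hom := inferInstance
  haveI : LocallyOfFiniteType S.hom := inferInstance
  -- (1) descent to a countable subfield
  obtain ⟨k, _, _, σ, 𝒳₀, S₀, f₀, e𝒳, eS, hcomm⟩ :=
    Literature.AlgebraicGeometry.Limits.exists_countable_subfield_descent f
  -- (2) transport of the hypotheses to `f₀ ⊗_σ ℂ`
  have hf' : IsSmoothProjectiveFamily ((baseChangeHom σ).map f₀) n :=
    IsSmoothProjectiveFamily.of_arrowIso e𝒳 eS hcomm hf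
  obtain ⟨hirr', haff', hsm', hdim'⟩ := base_hypotheses_of_iso (S' := (baseChangeHom σ).obj S₀) eS hdim
  have h𝒳' : IsQuasiProjectiveOver ((baseChangeHom σ).obj 𝒳₀) := isQuasiProjectiveOver_of_iso e𝒳 h𝒳
  have hA' := fibrewise_rational_hodgeType_of_arrowIso e𝒳 eS hcomm A hA
  have hs₀' : complexBetti.map (fiberι ((baseChangeHom σ).map f₀) (AlgPoints.map eS.inv s₀)) (2 * p)
      (complexBetti.map e𝒳.hom (2 * p) A) ∈
        algebraicClasses (fiberOver ((baseChangeHom σ).map f₀) (AlgPoints.map eS.inv s₀)) p :=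
    (map_fiberι_mem_algebraicClasses_iff_of_arrowIso e𝒳 eS hcomm A
      (AlgPoints.map_hom_map_inv_apply eS s₀)).mpr hs₀
  -- (3) the descended statement and transport of the conclusion back
  have h := variationalHodgeDescendedQP_of_padicQP hSQP hP k σ f₀ hf' hirr' haff' hsm' hdim'
    h𝒳' p (complexBetti.map e𝒳.hom (2 * p) A) hA' ⟨AlgPoints.map eS.inv s₀, hs₀'⟩
    (AlgPoints.map eS.inv s)
  exact (map_fiberι_mem_algebraicClasses_iff_of_arrowIso e𝒳 eS hcomm A
    (AlgPoints.map_hom_map_inv_apply eS s)).mp h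

/-- **`P ∧ S_QP ⟹` the variational Hodge statement for PROJECTIVE smooth families over every smooth
irreducible base** (reduce to affine curve bases: `variationalHodge_projective_of_curveBase`, Mumford's
curve lemma discharged). [cite: MumfordAV1970, §6 Lemma] [cite: CharlesSchnell2014Notes, Conj. 11.3.1] -/
private theorem variationalHodge_projective_of_padicQP ⦃n : ℕ⦄ ⦃𝒳 S : SchemeOver ℂ⦄ (f : 𝒳 ⟶ S)
    (hf : IsSmoothProjectiveFamily f n)
    (hι : ∃ (N : ℕ) (ι : 𝒳 ⟶ projectiveSpace N ℂ ⊗ S), IsClosedImmersion ι.left ∧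
      ι ≫ CartesianMonoidalCategory.snd (projectiveSpace N ℂ) S = f)
    (hirr : IrreducibleSpace S.left) (hsm : AlgebraicGeometry.Smooth S.hom) (p : ℕ)
    (A : complexBetti 𝒳 (2 * p))
    (hA : ∀ s : ComplexPoints S, IsRationalClass (complexBetti.map (fiberι f s) (2 * p) A) ∧
      IsOfHodgeType n (fiberOver f s) (2 * p) p p (complexBetti.map (fiberι f s) (2 * p) A))
    (hs₀ : ∃ s₀ : ComplexPoints S,
      complexBetti.map (fiberι f s₀) (2 * p) A ∈ algebraicClasses (fiberOver f s₀) p)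
    (s : ComplexPoints S) :
    complexBetti.map (fiberι f s) (2 * p) A ∈ algebraicClasses (fiberOver f s) p :=
  variationalHodge_projective_of_curveBase mumford_smoothCurve_through_two_points_holds
    (fun _ _ S' f' hf' hι' hirr' haff' hsm' hdim' p' A' hA' hs₀' s' => by
      haveI := haff'
      haveI := hsm'
      exact curveResidualQP_of_padicQP hSQP hP f' hf'
        (isQuasiProjectiveOver_of_isClosedImmersion_of_isAffine hι') hirr' haff' hsm' hdim' p' A' hA'
        hs₀' s')
    f hf hι hirr hsm p A hA hs₀ s

/-- **`P ∧ S_QP ⟹` the variational Hodge statement for QUASI-PROJECTIVE total spaces over every smooth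
irreducible base** (`variationalHodge_quasiProjective_of_projective`).
[cite: Hartshorne1977, Ch. II §4 (projective morphisms) and Cor. 4.8 (e)] [cite: CharlesSchnell2014Notes, Conj. 11.3.1] -/
private theorem variationalHodge_quasiProjective_of_padicQP ⦃n : ℕ⦄ ⦃𝒳 S : SchemeOver ℂ⦄
    (f : 𝒳 ⟶ S) (hf : IsSmoothProjectiveFamily f n) (h𝒳 : IsQuasiProjectiveOver 𝒳)
    (hirr : IrreducibleSpace S.left) (hsm : AlgebraicGeometry.Smooth S.hom) (p : ℕ)
    (A : complexBetti 𝒳 (2 * p))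
    (hA : ∀ s : ComplexPoints S, IsRationalClass (complexBetti.map (fiberι f s) (2 * p) A) ∧
      IsOfHodgeType n (fiberOver f s) (2 * p) p p (complexBetti.map (fiberι f s) (2 * p) A))
    (hs₀ : ∃ s₀ : ComplexPoints S,
      complexBetti.map (fiberι f s₀) (2 * p) A ∈ algebraicClasses (fiberOver f s₀) p)
    (s : ComplexPoints S) :
    complexBetti.map (fiberι f s) (2 * p) A ∈ algebraicClasses (fiberOver f s) p :=
  variationalHodge_quasiProjective_of_projective
    (fun _ _ _ f' hf' hι' hirr' _ hsm' p' A' hA' hs₀' s' =>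
      variationalHodge_projective_of_padicQP hSQP hP f' hf' hι' hirr' hsm' p' A' hA' hs₀' s')
    f hf h𝒳 hirr hsm p A hA hs₀ s

omit hSQP in
/-- **`P ∧ S_QP ⟹ Ring2.Hypotheses.VariationalHodgeQP`**: on quasi-projective carriers the line
`padic-disc-transport` reduces the variational Hodge conjecture to the p-adic image-algebraization bet
(AMMN 2022 Conj. 1.3, `K₀`-form) and STUB S for quasi-projective total spaces only.
[cite: AntieauMathewMorrowNikolaus2022, Conj. 1.3 and Thm. D] [cite: CharlesSchnell2014Notes, Conj. 11.3.1] -/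
theorem variationalHodgeQP_of_padicQP
    (hSQP : ∀ (N : ℕ) (k : Type) [Field k] [Countable k] (σ : k →+* ℂ) ⦃n : ℕ⦄ ⦃𝒳₀ S₀ : SchemeOver k⦄
    (f₀ : 𝒳₀ ⟶ S₀), IsQuasiProjectiveOver ((baseChangeHom σ).obj 𝒳₀) →
    IsSmoothProjectiveFamily ((baseChangeHom σ).map f₀) n →
    IrreducibleSpace ((baseChangeHom σ).obj S₀).left → IsAffine ((baseChangeHom σ).obj S₀).left →
    AlgebraicGeometry.Smooth ((baseChangeHom σ).obj S₀).hom →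
    topologicalKrullDim ((baseChangeHom σ).obj S₀).left = 1 →
    ∀ (p : ℕ) (A : complexBetti ((baseChangeHom σ).obj 𝒳₀) (2 * p)),
    (∀ s : ComplexPoints ((baseChangeHom σ).obj S₀),
      IsRationalClass (complexBetti.map (fiberι ((baseChangeHom σ).map f₀) s) (2 * p) A) ∧
      IsOfHodgeType n (fiberOver ((baseChangeHom σ).map f₀) s) (2 * p) p p
        (complexBetti.map (fiberι ((baseChangeHom σ).map f₀) s) (2 * p) A)) →
    ∀ s₀ : ComplexPoints ((baseChangeHom σ).obj S₀),
      complexBetti.map (fiberι ((baseChangeHom σ).map f₀) s₀) (2 * p) A ∈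
        algebraicClasses (fiberOver ((baseChangeHom σ).map f₀) s₀) p →
    ∃ (q : ℕ) (_ : Fact q.Prime) (κ : Type) (_ : Field κ) (_ : CharP κ q) (_ : PerfectRing κ q)
      (_ : IsAlgClosed κ) (_ : Algebra (ZMod q) κ) (_ : Algebra.IsAlgebraic (ZMod q) κ)
      (𝒴 : SchemeOver (WittVector q κ))
      (ξ : ContinuousKZeroRat (Ideal.span {(q : WittVector q κ)}) 𝒴)
      (s : ComplexPoints ((baseChangeHom σ).obj S₀)) (ι : K(q, κ) →+* ℂ),
      N ≤ q ∧ WittScheme.IsSmoothProperModel n 𝒴 ∧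
      (∀ Z : Set (ComplexPoints ((baseChangeHom σ).obj S₀)),
        IsDefinedOver σ S₀ σ.fieldRange Z → s ∈ Z → Z = Set.univ) ∧
      Nonempty ((baseChangeHom ι).obj (WittScheme.genericFibre 𝒴) ≅
        fiberOver ((baseChangeHom σ).map f₀) s) ∧
      ((∃ η : KZeroRat 𝒴.left,
        KZeroRat.map (WittScheme.specialFibreι 𝒴) η =
          KZeroRat.map (specialFibreToTower 𝒴)
            (ContinuousKZeroRat.specialFibre (Ideal.span {(q : WittVector q κ)}) 𝒴 ξ)) →
        complexBetti.map (fiberι ((baseChangeHom σ).map f₀) s) (2 * p) A ∈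
          algebraicClasses (fiberOver ((baseChangeHom σ).map f₀) s) p)) :
    Ring2.Hypotheses.VariationalHodgeQP :=
  Ring2.Binders.variationalHodgeQP_iff_quasiProjectiveTotal.2
    fun _ _ _ f hf h𝒳 hirr hsm p A hA hs₀ s =>
      variationalHodge_quasiProjective_of_padicQP hSQP hP f hf h𝒳 hirr hsm p A hA hs₀ s

omit hSQP in
/-- **`P ∧ S_QP ⟹ Ring2.Hypotheses.FlatSectionsAlgebraicQP`** (Charles–Schnell's Conj. 11.3.1 on its
printed carriers), through `flatSectionsAlgebraicQP_of_variationalHodgeQP`.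
[cite: CharlesSchnell2014Notes, Conj. 11.3.1 and Thm. 11.3.4] -/
theorem flatSectionsAlgebraicQP_of_padicQP
    (hSQP : ∀ (N : ℕ) (k : Type) [Field k] [Countable k] (σ : k →+* ℂ) ⦃n : ℕ⦄ ⦃𝒳₀ S₀ : SchemeOver k⦄
    (f₀ : 𝒳₀ ⟶ S₀), IsQuasiProjectiveOver ((baseChangeHom σ).obj 𝒳₀) →
    IsSmoothProjectiveFamily ((baseChangeHom σ).map f₀) n →
    IrreducibleSpace ((baseChangeHom σ).obj S₀).left → IsAffine ((baseChangeHom σ).obj S₀).left →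
    AlgebraicGeometry.Smooth ((baseChangeHom σ).obj S₀).hom →
    topologicalKrullDim ((baseChangeHom σ).obj S₀).left = 1 →
    ∀ (p : ℕ) (A : complexBetti ((baseChangeHom σ).obj 𝒳₀) (2 * p)),
    (∀ s : ComplexPoints ((baseChangeHom σ).obj S₀),
      IsRationalClass (complexBetti.map (fiberι ((baseChangeHom σ).map f₀) s) (2 * p) A) ∧
      IsOfHodgeType n (fiberOver ((baseChangeHom σ).map f₀) s) (2 * p) p p
        (complexBetti.map (fiberι ((baseChangeHom σ).map f₀) s) (2 * p) A)) →
    ∀ s₀ : ComplexPoints ((baseChangeHom σ).obj S₀),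
      complexBetti.map (fiberι ((baseChangeHom σ).map f₀) s₀) (2 * p) A ∈
        algebraicClasses (fiberOver ((baseChangeHom σ).map f₀) s₀) p →
    ∃ (q : ℕ) (_ : Fact q.Prime) (κ : Type) (_ : Field κ) (_ : CharP κ q) (_ : PerfectRing κ q)
      (_ : IsAlgClosed κ) (_ : Algebra (ZMod q) κ) (_ : Algebra.IsAlgebraic (ZMod q) κ)
      (𝒴 : SchemeOver (WittVector q κ))
      (ξ : ContinuousKZeroRat (Ideal.span {(q : WittVector q κ)}) 𝒴)
      (s : ComplexPoints ((baseChangeHom σ).obj S₀)) (ι : K(q, κ) →+* ℂ),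
      N ≤ q ∧ WittScheme.IsSmoothProperModel n 𝒴 ∧
      (∀ Z : Set (ComplexPoints ((baseChangeHom σ).obj S₀)),
        IsDefinedOver σ S₀ σ.fieldRange Z → s ∈ Z → Z = Set.univ) ∧
      Nonempty ((baseChangeHom ι).obj (WittScheme.genericFibre 𝒴) ≅
        fiberOver ((baseChangeHom σ).map f₀) s) ∧
      ((∃ η : KZeroRat 𝒴.left,
        KZeroRat.map (WittScheme.specialFibreι 𝒴) η =
          KZeroRat.map (specialFibreToTower 𝒴)
            (ContinuousKZeroRat.specialFibre (Ideal.span {(q : WittVector q κ)}) 𝒴 ξ)) →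
        complexBetti.map (fiberι ((baseChangeHom σ).map f₀) s) (2 * p) A ∈
          algebraicClasses (fiberOver ((baseChangeHom σ).map f₀) s) p)) :
    Ring2.Hypotheses.FlatSectionsAlgebraicQP :=
  Ring2.Hypotheses.flatSectionsAlgebraicQP_of_variationalHodgeQP
    (variationalHodgeQP_of_padicQP hP hSQP)

end PadicQP

end Summit.HodgeConjecture.HodgeConjecture.Theorems

end
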